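import Literature.NumberTheory.Automorphic.ResGL2BorelStabilizerFinite
import Literature.NumberTheory.Automorphic.ResGLnCohomologyFiniteDimensional
import Literature.NumberTheory.Automorphic.BorelOrbitsFinite
import Literature.NumberTheory.Automorphic.TwistedCohomologyFiniteOrbits
import HarnessLib

/-!
# The cohomology of the Borel stratum of `Res_{K/ℚ} GL₂` is finite-dimensional

Topic `NumberTheory/Automorphic`; namespace `Literature.NumberTheory.Automorphic`, grouping
sub-namespace `ResGLnCohomology`.  Definitions with bodies and theorems (no named fact, no
`sorry`).  Brick (B3) of the Eisenstein half of
`ResGLnCohomology.Harder1987_eigensystem_cuspidalOrEisenstein`: for ANY number field `K`, any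
`𝔫 ≠ 0`, any coefficient field `k` and any `λ`,

  `H^q(B(K)⁺, Fun(GL₂(𝔸_K^∞)/K_f(𝔫), E_λ(k)))`  (`ResGLnCohomology.borelPosCohomology`)

is finite-dimensional over `k` (`finiteDimensional_borelPosCohomology`) — the hypothesis
`[FiniteDimensional E (borelPosCohomology E K 𝔫 λ q)]` of the eigenvalue factorisation
`ResGL2BorelEigenvalueFactorisation.exists_borelPos_eigenvalue_factorisation`.  Proof: the orbits of
`B(K)` on `GL₂(𝔸_K^∞)/K_f(𝔫)` are finitely many with representatives `diag(t) c`, `c ∈ GL₂(𝒪̂)`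
(`ParallelWeight.exists_finite_cover_borelOrbits`, Iwasawa decomposition and finiteness of the class
group); `B(K) = ⋃_r B(K)⁺ diag(r, 1)` over a finite set of representatives `r` of the sign patterns
of `Kˣ` at the real places (`signReps`), so the `B(K)⁺`-orbits are finitely many with representatives
of the same shape (`exists_finite_cover_borelPosOrbits`); each stabiliser has finitely generated
cohomology (`ResGL2BorelStabilizerFinite.moduleFinite_groupCohomology_borelPosStabilizer`); conclude by
the Shapiro decomposition over the orbits (`TwistedQuotient.moduleFinite_cohomology_of_finite_cover`).
[cite: Harder1987, §2 (the boundary cohomology as a finite sum over the cusps of inductions from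
`Γ ∩ B`)]

## References

* G. Harder, *Eisenstein cohomology of arithmetic groups. The case GL₂*, Invent. Math. 89 (1987),
  §1–§2 [Harder1987].
-/

noncomputable section

open scoped NumberField
open IsDedekindDomain NumberField CategoryTheory

namespace Literature.NumberTheory.Automorphic

namespace ResGLnCohomology

open BigHeckeGLn ParallelWeight BorelLattice

variable (K : Type) [Field K] [NumberField K]

/-! ### Sign patterns at the real places and their representatives -/

variable {K} in
/-- The sign pattern `(sgn τ(x))_τ` of `x ∈ Kˣ` at the real embeddings. [folklore] -/
def signPattern (x : Kˣ) : (K →+* ℝ) → Bool :=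
  fun τ => decide (0 < τ (x : K))

variable {K} in
omit [NumberField K] in
/-- Elements with the same sign pattern have totally positive quotient. [folklore] -/
theorem pos_of_signPattern_eq {x r : Kˣ} (h : signPattern x = signPattern r) (τ : K →+* ℝ) :
    0 < τ ((x : K) * ((r⁻¹ : Kˣ) : K)) := by
  have hiff : 0 < τ (x : K) ↔ 0 < τ (r : K) := by
    have := congrFun h τ
    simpa [signPattern] using this
  have hr0 : τ (r : K) ≠ 0 := (map_ne_zero τ).2 r.ne_zero
  have hx0 : τ (x : K) ≠ 0 := (map_ne_zero τ).2 x.ne_zero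
  rw [map_mul, Units.val_inv_eq_inv_val, map_inv₀]
  rcases lt_or_gt_of_ne hr0 with hneg | hpos
  · have hxneg : τ (x : K) < 0 := lt_of_le_of_ne (not_lt.1 (mt hiff.1 (not_lt.2 hneg.le))) hx0
    exact mul_pos_of_neg_of_neg hxneg (inv_lt_zero.2 hneg)
  · exact mul_pos (hiff.2 hpos) (inv_pos.2 hpos)

open scoped Classical in
/-- A finite set of representatives of the sign patterns of `Kˣ` that occur. [folklore] -/
def signReps : Finset Kˣ :=
  Finset.univ.image fun s : (K →+* ℝ) → Bool => if h : ∃ x : Kˣ, signPattern x = s then h.choose else 1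

/-- Every `x ∈ Kˣ` has the sign pattern of some representative. [folklore] -/
theorem exists_signRep (x : Kˣ) : ∃ r ∈ signReps K, signPattern r = signPattern x := by
  classical
  refine ⟨_, Finset.mem_image.2 ⟨signPattern x, Finset.mem_univ _, rfl⟩, ?_⟩
  rw [dif_pos ⟨x, rfl⟩]
  exact Exists.choose_spec (⟨x, rfl⟩ : ∃ y : Kˣ, signPattern y = signPattern x)

variable {K}

omit [NumberField K] in
/-- `(r 0; 0 1) = diag(r, 1)`. [folklore] -/
theorem bMat_zero_eq_glDiagonal (r : Kˣ) : bMat r 0 1 = glDiagonal 2 K ![r, 1] := by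
  ext i j
  rw [coe_bMat, coe_glDiagonal]
  fin_cases i <;> fin_cases j <;> simp

/-! ### Finitely many `B(K)⁺`-orbits with representatives `diag(t) c` -/

variable {𝔫 : Ideal (𝓞 K)}

/-- **`GL₂(𝔸_K^∞)/K_f(𝔫)` is covered by finitely many `B(K)⁺`-orbits of points `diag(t) c K_f(𝔫)`,
`c ∈ GL₂(𝒪̂_K)`** (`𝔫 ≠ 0`): the `B(K)`-cover of `exists_finite_cover_borelOrbits` translated by
the finitely many `diag(r, 1)`, `r ∈ signReps K`, and `γ = (γ diag(r,1)⁻¹) diag(r,1)` with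
`γ diag(r, 1)⁻¹ ∈ B(K)⁺` for `r` of the sign pattern of `det γ`. [cite: Harder1987, §2] -/
theorem exists_finite_cover_borelPosOrbits (h𝔫 : 𝔫 ≠ 0) :
    ∃ s₁ : Finset (FiniteAdelicGL 2 K ⧸ level 2 K 𝔫),
      (∀ x ∈ s₁, ∃ t : Fin 2 → (FiniteAdeleRing (𝓞 K) K)ˣ, ∃ c ∈ glFiniteIntegralLevel 2 K,
        x = ((glDiagonal 2 (FiniteAdeleRing (𝓞 K) K) t * c : FiniteAdelicGL 2 K) :
          FiniteAdelicGL 2 K ⧸ level 2 K 𝔫)) ∧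
      ∀ y : FiniteAdelicGL 2 K ⧸ level 2 K 𝔫, ∃ x ∈ s₁, ∃ γ : borelPos K,
        ((diagPos 2 K).comp (borelPos K).subtype) γ • x = y := by
  classical
  obtain ⟨s₀, hs₀, hcov⟩ :
      ∃ s₀ : Finset (FiniteAdelicGL 2 K ⧸ level 2 K 𝔫),
        (∀ x ∈ s₀, ∃ t : Fin 2 → (FiniteAdeleRing (𝓞 K) K)ˣ, ∃ c ∈ glFiniteIntegralLevel 2 K,
          x = ((glDiagonal 2 (FiniteAdeleRing (𝓞 K) K) t * c : FiniteAdelicGL 2 K) :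
            FiniteAdelicGL 2 K ⧸ level 2 K 𝔫)) ∧
        ∀ y : FiniteAdelicGL 2 K ⧸ level 2 K 𝔫, ∃ x ∈ s₀, ∃ γ : borel K,
          ((globalEmbedding 2 K).comp (borel K).subtype) γ • x = y :=
    exists_finite_cover_borelOrbits h𝔫
  refine ⟨s₀.biUnion fun x => (signReps K).image fun r => globalEmbedding 2 K (bMat r 0 1) • x, ?_, ?_⟩
  · intro x' hx'
    obtain ⟨x, hx, hx''⟩ := Finset.mem_biUnion.1 hx'
    obtain ⟨r, -, rfl⟩ := Finset.mem_image.1 hx''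
    obtain ⟨t, c, hc, rfl⟩ := hs₀ x hx
    refine ⟨(fun i => IsDedekindDomain.FiniteAdeleRing.unitEmbedding (𝓞 K) K (![r, 1] i)) * t, c, hc, ?_⟩
    rw [MulAction.Quotient.smul_coe, smul_eq_mul, ← mul_assoc, bMat_zero_eq_glDiagonal,
      globalEmbedding_glDiagonal, ← map_mul]
  · intro y
    obtain ⟨x, hx, γ, hγ⟩ := hcov y
    obtain ⟨r, hr, hsgn⟩ := exists_signRep K (Matrix.GeneralLinearGroup.det (γ : GL (Fin 2) K))
    have hpos : (γ : GL (Fin 2) K) * (bMat r 0 1)⁻¹ ∈ glTotPos 2 K := by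
      rw [mem_glTotPos_iff]
      intro τ
      rw [map_mul, map_inv, det_bMat, mul_one, Units.val_mul]
      exact pos_of_signPattern_eq hsgn.symm τ
    have hbor : (⟨_, hpos⟩ : glTotPos 2 K) ∈ borelPos K := by
      rw [mem_borelPos_iff_coe_mem_borel]
      exact (borel K).mul_mem γ.2 ((borel K).inv_mem (bMat_mem_borel r 0 1))
    refine ⟨globalEmbedding 2 K (bMat r 0 1) • x,
      Finset.mem_biUnion.2 ⟨x, hx, Finset.mem_image.2 ⟨r, hr, rfl⟩⟩, ⟨⟨_, hpos⟩, hbor⟩, ?_⟩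
    rw [← hγ]
    change globalEmbedding 2 K ((γ : GL (Fin 2) K) * (bMat r 0 1)⁻¹) • globalEmbedding 2 K (bMat r 0 1) • x =
      globalEmbedding 2 K (γ : GL (Fin 2) K) • x
    rw [← mul_smul, ← map_mul, inv_mul_cancel_right]

/-! ### Finite-dimensionality of the Borel stratum -/

/-- **`H^q(B(K)⁺, Fun(GL₂(𝔸_K^∞)/K_f(𝔫), E_λ(k)))` is finite-dimensional** over any field `k`, for
any number field `K`, `𝔫 ≠ 0`, `λ` and `q`: finitely many `B(K)⁺`-orbits
(`exists_finite_cover_borelPosOrbits`), finitely generated stabiliser cohomology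
(`moduleFinite_groupCohomology_borelPosStabilizer`, coefficients `E_λ(k)` finite-dimensional by
`finiteDimensional_coeffModule'`), and the decomposition of the twisted cohomology over the orbits
(`TwistedQuotient.moduleFinite_cohomology_of_finite_cover`). [cite: Harder1987, §2] -/
theorem finiteDimensional_borelPosCohomology (k : Type) [Field k] (h𝔫 : 𝔫 ≠ 0)
    (lam : (K →+* k) → Fin 2 → ℤ) (q : ℕ) : FiniteDimensional k (borelPosCohomology k K 𝔫 lam q) := by
  classical
  obtain ⟨s₁, hs₁, hcov⟩ := exists_finite_cover_borelPosOrbits (K := K) h𝔫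
  refine TwistedQuotient.moduleFinite_cohomology_of_finite_cover ((diagPos 2 K).comp (borelPos K).subtype)
    (level 2 K 𝔫) ((coeffRepPos k 2 K lam).comp (borelPos K).subtype) s₁ hcov q fun x hx => ?_
  obtain ⟨t, c, hc, rfl⟩ := hs₁ x hx
  exact @moduleFinite_groupCohomology_borelPosStabilizer K _ _ 𝔫 h𝔫 t c hc k _ _ _
    (finiteDimensional_coeffModule' k 2 K lam) q

end ResGLnCohomology

end Literature.NumberTheory.Automorphic

end
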